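import Literature.MathematicalPhysics.QuantumFieldTheory.ConformalBootstrap3D.PointKernelK34v2Data

/-!
# K34v2 certificate, kernel block file H2: head segments `24 ≤ i < 34` (block-checked ones)

`decide` by kernel reduction (no `native_decide`, no extra axioms) of the block checker
`PCert.hBlockOK` of `PointKernel` on the literal data of `PointKernelK34v2Data` (cells checked corner
or chord by the rule bit); soundness is `PCert.hBlockOK_sound`.  Estimated kernel time 251 s
(5 theorems).
-/

set_option maxRecDepth 100000
set_option maxHeartbeats 0

namespace Literature.MathematicalPhysics.QuantumFieldTheory.ConformalBootstrap3D.PointKernelK34v2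

open Literature.MathematicalPhysics.QuantumFieldTheory.ConformalBootstrap3D.PointKernel

/-- head segments `[24, 26)` pass the kernel evaluator (≈47 s of kernel work). [folklore] -/
theorem hBlock_24 : certK34v2.hBlockOK hsegsK34v2 24 26 JHK34v2 = true := by
  decide +kernel

/-- head segments `[26, 28)` pass the kernel evaluator (≈47 s of kernel work). [folklore] -/
theorem hBlock_26 : certK34v2.hBlockOK hsegsK34v2 26 28 JHK34v2 = true := by
  decide +kernel

/-- head segments `[28, 30)` pass the kernel evaluator (≈47 s of kernel work). [folklore] -/
theorem hBlock_28 : certK34v2.hBlockOK hsegsK34v2 28 30 JHK34v2 = true := by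
  decide +kernel

/-- head segments `[30, 32)` pass the kernel evaluator (≈47 s of kernel work). [folklore] -/
theorem hBlock_30 : certK34v2.hBlockOK hsegsK34v2 30 32 JHK34v2 = true := by
  decide +kernel

/-- head segments `[32, 34)` pass the kernel evaluator (≈47 s of kernel work). [folklore] -/
theorem hBlock_32 : certK34v2.hBlockOK hsegsK34v2 32 34 JHK34v2 = true := by
  decide +kernel

end Literature.MathematicalPhysics.QuantumFieldTheory.ConformalBootstrap3D.PointKernelK34v2
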